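import Mathlib
import Summits.MatrixMultiplication.MatrixMultiplication.Theorems.GradedDesignFamily.Negative.SubfieldCellUnipotent

/-!
# Field-side toolkit for route (D′): the copy of `k` inside `K`, roots of unity, torus bounds
# (crux `LevelGradedCohnUmans.GradedDesignFamily`, stmt-MatrixMultiplication-7610; negative side,
# line `quadratic-extension-level-one-cell`, unit b2b-lgcu-subfield gen 18)

HONEST FRAMING.  After gen 18, `¬ stub_subfieldCell ⇐ (BGT) ∧ (Dickson)`; route (D′) of the cell doc
(SUBFIELD.md §23.6) wants to replace (Dickson) by an overgroup statement for `SL₂(q) ≤ SL₂(q²)`.  In the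
cell the fields `k`, `K` are ABSTRACT with `|K| = |k|²` and `φ : SL₂(k) →* GL₂(K)` is an abstract hom, so
the identification of "the subfield of order `q`" and of the torus eigenvalues has to be earned.  This
file lands the field-side facts that identification uses:

* `subfieldCell_nonempty_ringHom` — `|K| = |k|²` gives a ring embedding `ι : k →+* K`;
* `subfieldCell_exists_eq_of_pow_eq_one` — every `x : K` with `x ^ (|k| - 1) = 1` is `ι a` for some
  `a ≠ 0` (so the eigenvalue group `θ(kˣ)` of `φ(torus)` lies in `ι(k)`);
* `subfieldCell_exists_eq_iff_pow_card` — `x ∈ ι(k) ↔ x ^ |k| = x`;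
* `card_le_card_of_mul_mem` / `card_le_two_mul_card_image_sq` / `card_le_two_mul_of_sq_mul_mem` — if
  the squares of a finite set `M` of field elements multiply a finite piece `A ∋ a ≠ 0` into `A`, then
  `|M| ≤ 2·|A|` (the torus bound `τ ≤ 2(q₀ - 1) + 2` of (D′2)).

Support lemmas only; NOT summit progress.  Sorry-free. [folklore]
-/

set_option linter.dupNamespace false

namespace Summit.MatrixMultiplication.MatrixMultiplication.Theorems.GradedDesignFamily.Negative

section Embedding

variable {k K : Type} [Field k] [Fintype k] [Field K]

/-- **(F1)** In the quadratic-extension cell `|K| = |k|²` there is a ring embedding `k →+* K`.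
[folklore] -/
theorem subfieldCell_nonempty_ringHom [Fintype K] (hK : Fintype.card K = Fintype.card k ^ 2) :
    Nonempty (k →+* K) := by
  haveI : CharP K (ringChar k) := subfieldCell_charP hK
  obtain ⟨n, hp, -⟩ := FiniteField.card k (ringChar k)
  haveI : Fact (ringChar k).Prime := ⟨hp⟩
  letI : Algebra (ZMod (ringChar k)) k := ZMod.algebra _ _
  letI : Algebra (ZMod (ringChar k)) K := ZMod.algebra _ _
  have h1 := FiniteField.pow_finrank_eq_card (ringChar k) k
  have h2 := FiniteField.pow_finrank_eq_card (ringChar k) K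
  have hdvd : Module.finrank (ZMod (ringChar k)) k ∣ Module.finrank (ZMod (ringChar k)) K := by
    have h3 : ringChar k ^ Module.finrank (ZMod (ringChar k)) K =
        ringChar k ^ (2 * Module.finrank (ZMod (ringChar k)) k) := by
      rw [h2, hK, ← h1, ← pow_mul, mul_comm]
    rw [Nat.pow_right_injective hp.two_le h3]
    exact dvd_mul_left _ _
  obtain ⟨f⟩ := FiniteField.nonempty_algHom_of_finrank_dvd hdvd
  exact ⟨f.toRingHom⟩

/-- **(F2)** Roots of unity of order dividing `|k| - 1` in `K` come from `k`: if `x ^ (|k| - 1) = 1`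
then `x = ι a` for some `a ≠ 0`.  (Counting: `ι(kˣ)` already supplies `|k| - 1` roots of
`X ^ (|k|-1) - 1`.) [folklore] -/
theorem subfieldCell_exists_eq_of_pow_eq_one (ι : k →+* K) {x : K}
    (hx : x ^ (Fintype.card k - 1) = 1) : ∃ a : k, a ≠ 0 ∧ ι a = x := by
  classical
  have hnpos : 0 < Fintype.card k - 1 := by
    have := Fintype.one_lt_card (α := k)
    omega
  set T : Finset K := (Finset.univ.filter (fun a : k => a ≠ 0)).image ι with hT
  have hTsub : T ⊆ Polynomial.nthRootsFinset (Fintype.card k - 1) (1 : K) := by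
    intro y hy
    obtain ⟨a, ha, rfl⟩ := Finset.mem_image.mp hy
    have ha0 : a ≠ 0 := (Finset.mem_filter.mp ha).2
    rw [Polynomial.mem_nthRootsFinset hnpos, ← map_pow, FiniteField.pow_card_sub_one_eq_one a ha0,
      map_one]
  have hTcard : T.card = Fintype.card k - 1 := by
    rw [hT, Finset.card_image_of_injective _ ι.injective, Finset.filter_ne',
      Finset.card_erase_of_mem (Finset.mem_univ _), Finset.card_univ]
  have hRcard : (Polynomial.nthRootsFinset (Fintype.card k - 1) (1 : K)).card ≤ Fintype.card k - 1 := by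
    rw [Polynomial.nthRootsFinset_def]
    exact (Multiset.toFinset_card_le _).trans (Polynomial.card_nthRoots _ _)
  have hTeq : T = Polynomial.nthRootsFinset (Fintype.card k - 1) (1 : K) :=
    Finset.eq_of_subset_of_card_le hTsub (by rw [hTcard]; exact hRcard)
  have hxmem : x ∈ Polynomial.nthRootsFinset (Fintype.card k - 1) (1 : K) :=
    (Polynomial.mem_nthRootsFinset hnpos 1).mpr hx
  rw [← hTeq] at hxmem
  obtain ⟨a, ha, hax⟩ := Finset.mem_image.mp hxmem
  exact ⟨a, (Finset.mem_filter.mp ha).2, hax⟩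

/-- **(F3)** The image of `ι : k →+* K` is the fixed set of the `|k|`-th power map. [folklore] -/
theorem subfieldCell_exists_eq_iff_pow_card (ι : k →+* K) (x : K) :
    (∃ a : k, ι a = x) ↔ x ^ Fintype.card k = x := by
  constructor
  · rintro ⟨a, rfl⟩
    rw [← map_pow, FiniteField.pow_card]
  · intro hx
    by_cases hx0 : x = 0
    · exact ⟨0, by rw [map_zero, hx0]⟩
    · have hq : 1 ≤ Fintype.card k := Fintype.card_pos
      have hx1 : x ^ (Fintype.card k - 1) = 1 := by
        have h : x ^ (Fintype.card k - 1) * x = 1 * x := by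
          rw [← pow_succ, Nat.sub_add_cancel hq, hx, one_mul]
        exact mul_right_cancel₀ hx0 h
      obtain ⟨a, -, ha⟩ := subfieldCell_exists_eq_of_pow_eq_one ι hx1
      exact ⟨a, ha⟩

end Embedding

section Torus

variable {K : Type} [Field K]

/-- Multipliers of a finite piece: if every `c ∈ C` satisfies `c * a ∈ A` for a fixed `a ∈ A`,
`a ≠ 0`, then `|C| ≤ |A|`. [folklore] -/
theorem card_le_card_of_mul_mem (A C : Finset K) {a : K} (ha0 : a ≠ 0)
    (hC : ∀ c ∈ C, c * a ∈ A) : C.card ≤ A.card :=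
  Finset.card_le_card_of_injOn (· * a) (fun c hc => hC c hc)
    (fun _ _ _ _ h => mul_right_cancel₀ ha0 h)

/-- Squaring has fibres of size `≤ 2` in a field: `|M| ≤ 2·|M²|`. [folklore] -/
theorem card_le_two_mul_card_image_sq [DecidableEq K] (M : Finset K) :
    M.card ≤ 2 * (M.image (fun m => m ^ 2)).card := by
  refine Finset.card_le_mul_card_image _ 2 (fun c hc => ?_)
  obtain ⟨m₀, -, rfl⟩ := Finset.mem_image.mp hc
  calc (M.filter (fun m => m ^ 2 = m₀ ^ 2)).card ≤ ({m₀, -m₀} : Finset K).card := by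
        refine Finset.card_le_card (fun m hm => ?_)
        rw [Finset.mem_filter] at hm
        rcases sq_eq_sq_iff_eq_or_eq_neg.mp hm.2 with h | h <;> simp [h]
    _ ≤ 2 := Finset.card_le_two

/-- **Torus bound.**  If the squares of the elements of `M` multiply a fixed `a ∈ A`, `a ≠ 0`, into
the finite piece `A`, then `|M| ≤ 2·|A|` (used with `A` = a root group `≅` its additive parameter
set and `M` = the eigenvalues of the stabiliser of the root line, which act on `A` by squares).
[folklore] -/
theorem card_le_two_mul_of_sq_mul_mem [DecidableEq K] (A M : Finset K) {a : K} (ha : a ∈ A)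
    (ha0 : a ≠ 0) (hM : ∀ m ∈ M, ∀ x ∈ A, m ^ 2 * x ∈ A) : M.card ≤ 2 * A.card := by
  calc M.card ≤ 2 * (M.image (fun m => m ^ 2)).card := card_le_two_mul_card_image_sq M
    _ ≤ 2 * A.card := by
        refine Nat.mul_le_mul_left 2 (card_le_card_of_mul_mem A _ ha0 (fun c hc => ?_))
        obtain ⟨m, hm, rfl⟩ := Finset.mem_image.mp hc
        exact hM m hm a ha

end Torus

end Summit.MatrixMultiplication.MatrixMultiplication.Theorems.GradedDesignFamily.Negative
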